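import Summits.QuantumFields.YangMills.Theorems.BalabanUVNodesN15KingModelAnalyticHolomorphy
import Mathlib.Analysis.Complex.Liouville
import Mathlib.Analysis.Calculus.MeanValue
import HarnessLib

/-!
# BalabanUVNodes ∕ N15 — THE KING-MODEL RUNG (PART Ϩ-i): CAUCHY ESTIMATES WITH DECAY, AND THE `η`-UNIFORM LIPSCHITZ DEPENDENCE OF THE KERNELS ON THE LINK FIELD — along every complex
# line `U₀ + tδU` (`‖δU_b‖ ≤ ε`) inside Bałaban's polydisc the kernel blocks `t ↦ blk G(U₀+tδU,(U₀+tδU)⁻¹) x y` are holomorphic for `|t| ≤ R`, `LRε ≤ s₀`, bounded by `(8∕κ)e^{−δd(x,y)∕L}`; hence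
# ALL TAYLOR COEFFICIENTS IN THE FIELD DECAY EXPONENTIALLY (`k!(8∕κ)e^{−δd∕L}R^{−k}`) and ★★★★ `‖blk(A₀(U₁)⁻¹ − A₀(U₀)⁻¹) x y‖ ≤ (16∕κ)(Lε∕s₀)e^{−δd(x,y)∕L}` for unitary `U₀, U₁` with
# `‖U₁ − U₀‖ ≤ ε`, `2Lε ≤ s₀` — LIPSCHITZ IN `U` ON BAŁABAN's SCALE WITH THE `η`-UNIFORM CONSTANT AND THE DECAY (door (t9⁵⁶) of PART Ϧ: the `O(L²ε)` operator-currency constant of Ϧ-f is gone)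
# (Track A, DAG node N15 = NE2; FAN-OUT v1.1 §N15 s3 «KING-MODEL RUNG … + what the curved case adds»; count-neutral)

HONEST FRAMING.  Count-neutral (cell `pub-ymgap`, seat `pub-ymgap-dag-n15-e` g51; `--supports stmt-QuantumFields-27247 --as helper` = K3ᴬ, KEY MAP v3).  `𝕜 = ℂ` (Cauchy); King's one-level
comparison model; the analyticity and the bounds are PART Ϩ-g∕Ϩ-h; Mathlib's Cauchy estimate on circles and the mean value inequality on the unit disc.  NOT Bałaban's multi-level `G_k(U)`
nor (3.47)–(3.57) as printed; NOT a node discharge (N15 of record untouched); nothing continuum ∕ ℝ⁴ ∕ OS ∕ Clay.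

THE RESULTS (comb-depth contour system, `L ≥ 1`, `a, m² ≥ 0`, unitary `U₀` with `κ`-coercive `A₀(U₀)` in King's scaling; direction `‖δU_b‖ ≤ ε`, radius `R > 0` with `L·R·ε ≤ s₀(κ,a,d)`;
`f_{xy}(t) = blk G(U₀+tδU, (U₀+tδU)⁻¹) x y`, `δ = ctRate(κ∕2,a,d)`):
* §1 `norm_line_sub_le` (`‖(U₀+tδU)_b − U₀_b‖ ≤ ‖t‖ε`), ★ `differentiableAt_blk_printLine` (`|t| ≤ R`), ★ `diffContOnCl_blk_printLine` (on `|t| < R`), ★ `norm_blk_printLine_le` (`‖f_{xy}(t)‖ ≤ (8∕κ)e^{−δd∕L}`, `|t| ≤ R`).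
* §2 ★★★ **`norm_iteratedDeriv_blk_printLine_le`** — CAUCHY WITH DECAY: `‖f_{xy}^{(k)}(0)‖ ≤ k!·(8∕κ)e^{−δd(x,y)∕L}∕Rᵏ` for every `k` (the perturbation series of the kernel in the link field has
  exponentially decaying coefficients, uniformly in the volume; [B9] (3.57)'s shape), ★★ `norm_deriv_blk_printLine_le` (`k = 1` anywhere in the half disc: `≤ (8∕κ)e^{−δd∕L}∕(R∕2)`).
* §3 ★★★★ **`norm_blk_printMap_sub_le`** (`R ≥ 2`: `‖f_{xy}(1) − f_{xy}(0)‖ ≤ (16∕κ)e^{−δd∕L}∕R`), ★★★★ **`norm_blk_fullOpU_inv_sub_le_eta_uniform`** — for UNITARY `U₀, U₁` with `‖U₁_b − U₀_b‖ ≤ ε`,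
  `0 < ε`, `2Lε ≤ s₀(κ,a,d)`: `‖blk (A₀(U₁)⁻¹ − A₀(U₀)⁻¹) x y‖ ≤ (16∕κ)·(Lε∕s₀(κ,a,d))·e^{−ctRate(κ∕2,a,d)d(x,y)∕L}` — LINEAR IN `Lε = ε∕η` with a constant depending on `(κ,a,d)` ONLY, times the
  decay; ★★★ `norm_blk_fullOpU_inv_sub_le_small_curvature` (the class: all constants functions of `(m²,a,d,ε₀)`).
PRIOR TREE ART (by name): Ϩ-h (`analyticAt_printMap`, `printMap_at_unitary`), Ϩ-g (`sliceRadius`, `sliceRadius_pos∕_le`, `norm_blk_cxFullOp_inv_at_radius_le`), Ϩ-a (`cxFullOp_inv_of_unitary`), Ϛ-a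
(`blk_sub'`), Ϥ-o (`re_quadForm_fullOpU_ge_uniform_of_small_curvature`), Mathlib (`Complex.norm_iteratedDeriv_le_of_forall_mem_sphere_norm_le`, `Complex.norm_deriv_le_of_forall_mem_sphere_norm_le`,
`Convex.norm_image_sub_le_of_norm_deriv_le`, `convex_closedBall`).  Dedup (rg at filing): basename 0 files; needles `printLine|norm_blk_printMap_sub_le|eta_uniform` 0 tree files.  presearch: n/a
(Cauchy estimates; [B9] proves the analogous bounds for `G_k(U)` by the random-walk expansion (3.47)–(3.57) — different method, same shape).  Locators: [Balaban1985BackgroundPropagators] Thm 3.4 p.400,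
(3.48)–(3.53) pp.398–400, (3.57) p.401, Thm 3.1 p.397; [King1986] (4.33) p.674.  0 `sorry`, 0 `def`.
-/

noncomputable section
open scoped BigOperators ComplexConjugate ComplexOrder Topology Matrix.Norms.L2Operator
open Finset Matrix Filter Metric Set

namespace Summit.QuantumFields.YangMills.BalabanUVNodes.N15KingModelRung.Analytic

open Literature.MathematicalPhysics.QuantumFieldTheory.LatticeDiamagneticInequality (blk)
open Literature.MathematicalPhysics.QuantumFieldTheory.Balaban1983to89.B5Prop11Plancherel (Tor fine unitVec)
open Literature.MathematicalPhysics.QuantumFieldTheory.King1986.Torus (tdistT)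
open Summit.QuantumFields.YangMills.BalabanUVNodes.N15KingModelRung.Covariant (CxLinks blk_sub' fib)
open Summit.QuantumFields.YangMills.BalabanUVNodes.N15KingModelRung.CovariantBlock (BlockTree kingComb kingComb_depth_le fullOpU re_quadForm_fullOpU_ge_uniform_of_small_curvature)
open Summit.QuantumFields.YangMills.BalabanUVNodes.N15KingModelRung.CombesThomas (ctRate)
open Summit.QuantumFields.YangMills.BalabanUVNodes.N15KingModelRung.Cover (kingPlaq)

variable {d : ℕ} {L : ℕ} [NeZero L] (T : BlockTree d L) (M : Fin (d + 1) → ℕ) [hM : ∀ μ, NeZero (M μ)]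
variable {n : Type*} [Fintype n] [DecidableEq n]

/-! ## §1 Complex lines inside Bałaban's polydisc -/

section Line

variable (hD : ∀ j, T.depth j ≤ (d + 1) * (L - 1)) {a m2 : ℝ} (ha : 0 ≤ a) (hm : 0 ≤ m2) (hL : 1 ≤ L)
variable {U₀ : Tor (fine L M) × Fin (d + 1) → Matrix n n ℂ} (hU₀ : ∀ bd, U₀ bd ∈ Matrix.unitaryGroup n ℂ) {κ : ℝ} (hκ : 0 < κ)
  (hcoer : ∀ v : Tor (fine L M) × n → ℂ, κ * ∑ x, ‖fib (fine L M) v x‖ ^ 2 ≤ RCLike.re (star v ⬝ᵥ (fullOpU T M a ((L : ℝ) ^ 2) m2 U₀ *ᵥ v)))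
variable {δU : Tor (fine L M) × Fin (d + 1) → Matrix n n ℂ} {ε R : ℝ} (hε0 : 0 ≤ ε) (hδU : ∀ bd, ‖δU bd‖ ≤ ε) (hR : 0 < R) (hrad : (L : ℝ) * (R * ε) ≤ sliceRadius κ a d)
include hD ha hm hL hU₀ hκ hcoer hε0 hδU hR hrad

omit [NeZero L] hM hD ha hm hL hU₀ hκ hcoer hε0 hR hrad in
/-- A point of the line: `‖(U₀ + tδU)_b − U₀_b‖ ≤ ‖t‖·ε`. [folklore] -/
theorem norm_line_sub_le (t : ℂ) (bd : Tor (fine L M) × Fin (d + 1)) : ‖(U₀ + t • δU) bd - U₀ bd‖ ≤ ‖t‖ * ε := by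
  rw [Pi.add_apply, Pi.smul_apply, add_sub_cancel_left, norm_smul]
  exact mul_le_mul_of_nonneg_left (hδU bd) (norm_nonneg t)

/-- ★ THE KERNEL BLOCK ALONG THE LINE IS ℂ-DIFFERENTIABLE at every `|t| ≤ R` (Ϩ-h `analyticAt_printMap` ∘ the affine line). [cite: Balaban1985BackgroundPropagators, Thm 3.4 p.400] -/
theorem differentiableAt_blk_printLine {t : ℂ} (ht : ‖t‖ ≤ R) (x y : Tor (fine L M)) :
    DifferentiableAt ℂ (fun s : ℂ => blk (cxFullOp T M a ((L : ℝ) ^ 2) m2 (U₀ + s • δU) (fun bd => ((U₀ + s • δU) bd)⁻¹))⁻¹ x y) t := by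
  have hline : DifferentiableAt ℂ (fun s : ℂ => U₀ + s • δU) t := (differentiableAt_id.smul_const δU).const_add U₀
  have hUt : ∀ bd, ‖(U₀ + t • δU) bd - U₀ bd‖ ≤ R * ε := fun bd => (norm_line_sub_le M hδU t bd).trans (mul_le_mul_of_nonneg_right ht hε0)
  have hG := analyticAt_printMap T M hD ha hm hL hU₀ hκ hcoer (mul_nonneg hR.le hε0) hUt hrad
  have hcomp : (fun s : ℂ => blk (cxFullOp T M a ((L : ℝ) ^ 2) m2 (U₀ + s • δU) (fun bd => ((U₀ + s • δU) bd)⁻¹))⁻¹ x y)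
      = (fun A => blk A x y) ∘ (fun W : Tor (fine L M) × Fin (d + 1) → Matrix n n ℂ => (cxFullOp T M a ((L : ℝ) ^ 2) m2 W (fun bd => (W bd)⁻¹))⁻¹) ∘ (fun s : ℂ => U₀ + s • δU) := rfl
  rw [hcomp]
  have hGl : DifferentiableAt ℂ ((fun W : Tor (fine L M) × Fin (d + 1) → Matrix n n ℂ => (cxFullOp T M a ((L : ℝ) ^ 2) m2 W (fun bd => (W bd)⁻¹))⁻¹) ∘ (fun s : ℂ => U₀ + s • δU)) t :=
    hG.differentiableAt.comp t hline
  exact ((Covariant.cxBlkCLM (fine L M) ℂ n x y).analyticAt _).differentiableAt.comp t hGl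

/-- ★ `DiffContOnCl` on the disc `|t| < R`. [cite: Balaban1985BackgroundPropagators, Thm 3.4 p.400] -/
theorem diffContOnCl_blk_printLine (x y : Tor (fine L M)) :
    DiffContOnCl ℂ (fun s : ℂ => blk (cxFullOp T M a ((L : ℝ) ^ 2) m2 (U₀ + s • δU) (fun bd => ((U₀ + s • δU) bd)⁻¹))⁻¹ x y) (ball (0 : ℂ) R) := by
  refine DifferentiableOn.diffContOnCl ?_
  rw [closure_ball (0 : ℂ) hR.ne']
  intro t ht
  have htR : ‖t‖ ≤ R := by simpa only [mem_closedBall, dist_zero_right] using ht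
  exact (differentiableAt_blk_printLine T M hD ha hm hL hU₀ hκ hcoer hε0 hδU hR hrad htR x y).differentiableWithinAt

/-- ★ THE UNIFORM BOUND ON THE CLOSED DISC: `‖f_{xy}(t)‖ ≤ (8∕κ)e^{−ctRate(κ∕2,a,d)·d(x,y)∕L}` for `|t| ≤ R`. [cite: Balaban1985BackgroundPropagators, Thm 3.4 p.400, Thm 3.1 p.397] -/
theorem norm_blk_printLine_le {t : ℂ} (ht : ‖t‖ ≤ R) (x y : Tor (fine L M)) :
    ‖blk (cxFullOp T M a ((L : ℝ) ^ 2) m2 (U₀ + t • δU) (fun bd => ((U₀ + t • δU) bd)⁻¹))⁻¹ x y‖ ≤ 8 / κ * Real.exp (-(ctRate (κ / 2) a d / L * tdistT (fine L M) x y)) := by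
  have hUt : ∀ bd, ‖(U₀ + t • δU) bd - U₀ bd‖ ≤ R * ε := fun bd => (norm_line_sub_le M hδU t bd).trans (mul_le_mul_of_nonneg_right ht hε0)
  exact norm_blk_cxFullOp_inv_at_radius_le T M hD ha hm hL hU₀ hκ hcoer (mul_nonneg hR.le hε0) hUt hrad x y

/-! ## §2 Cauchy's estimates with decay -/

/-- ★★★ **CAUCHY's ESTIMATE WITH DECAY, ALL ORDERS**: `‖f_{xy}^{(k)}(0)‖ ≤ k!·(8∕κ)e^{−ctRate(κ∕2,a,d)d(x,y)∕L}∕Rᵏ` — the `k`-th Taylor coefficient of the kernel block in the link field along any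
direction of size `ε` is `≤ (8∕κ)e^{−δd∕L}(1∕R)ᵏ` with `R = s₀∕(Lε)` admissible: exponentially decaying coefficients, uniformly in the volume and the fibre. [cite: Balaban1985BackgroundPropagators, Thm 3.4 p.400, (3.57) p.401] -/
theorem norm_iteratedDeriv_blk_printLine_le (k : ℕ) (x y : Tor (fine L M)) :
    ‖iteratedDeriv k (fun s : ℂ => blk (cxFullOp T M a ((L : ℝ) ^ 2) m2 (U₀ + s • δU) (fun bd => ((U₀ + s • δU) bd)⁻¹))⁻¹ x y) 0‖
      ≤ k.factorial * (8 / κ * Real.exp (-(ctRate (κ / 2) a d / L * tdistT (fine L M) x y))) / R ^ k := by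
  haveI : CompleteSpace (Matrix n n ℂ) := FiniteDimensional.complete ℂ _
  refine Complex.norm_iteratedDeriv_le_of_forall_mem_sphere_norm_le k hR (diffContOnCl_blk_printLine T M hD ha hm hL hU₀ hκ hcoer hε0 hδU hR hrad x y) fun t ht => ?_
  have htR : ‖t‖ = R := by simpa only [mem_sphere, dist_zero_right] using ht
  exact norm_blk_printLine_le T M hD ha hm hL hU₀ hκ hcoer hε0 hδU hR hrad htR.le x y

/-- ★★ **THE FIRST DERIVATIVE ANYWHERE IN THE HALF DISC**: for `‖s‖ ≤ R∕2`, `‖f_{xy}′(s)‖ ≤ (8∕κ)e^{−δd∕L}∕(R∕2)` (Cauchy on the circle of radius `R∕2` about `s`).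
[cite: Balaban1985BackgroundPropagators, Thm 3.4 p.400, (3.48)–(3.50) pp.398–400] -/
theorem norm_deriv_blk_printLine_le {s : ℂ} (hs : ‖s‖ ≤ R / 2) (x y : Tor (fine L M)) :
    ‖deriv (fun s : ℂ => blk (cxFullOp T M a ((L : ℝ) ^ 2) m2 (U₀ + s • δU) (fun bd => ((U₀ + s • δU) bd)⁻¹))⁻¹ x y) s‖
      ≤ (8 / κ * Real.exp (-(ctRate (κ / 2) a d / L * tdistT (fine L M) x y))) / (R / 2) := by
  have hR2 : 0 < R / 2 := by positivity
  refine Complex.norm_deriv_le_of_forall_mem_sphere_norm_le hR2 ?_ fun t ht => ?_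
  · refine DifferentiableOn.diffContOnCl ?_
    rw [closure_ball s hR2.ne']
    intro t ht
    have hts : ‖t - s‖ ≤ R / 2 := by simpa only [mem_closedBall, dist_eq_norm] using ht
    have htR : ‖t‖ ≤ R := by
      calc ‖t‖ = ‖(t - s) + s‖ := by rw [sub_add_cancel]
        _ ≤ ‖t - s‖ + ‖s‖ := norm_add_le _ _
        _ ≤ R / 2 + R / 2 := add_le_add hts hs
        _ = R := by ring
    exact (differentiableAt_blk_printLine T M hD ha hm hL hU₀ hκ hcoer hε0 hδU hR hrad htR x y).differentiableWithinAt
  · have hts : ‖t - s‖ = R / 2 := by simpa only [mem_sphere, dist_eq_norm] using ht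
    have htR : ‖t‖ ≤ R := by
      calc ‖t‖ = ‖(t - s) + s‖ := by rw [sub_add_cancel]
        _ ≤ ‖t - s‖ + ‖s‖ := norm_add_le _ _
        _ ≤ R / 2 + R / 2 := add_le_add hts.le hs
        _ = R := by ring
    exact norm_blk_printLine_le T M hD ha hm hL hU₀ hκ hcoer hε0 hδU hR hrad htR x y

/-! ## §3 Lipschitz in the link field with the `η`-uniform constant and the decay -/

/-- ★★★★ **THE DIFFERENCE ACROSS THE LINE**: for `R ≥ 2`, `‖f_{xy}(1) − f_{xy}(0)‖ ≤ (16∕κ)·e^{−ctRate(κ∕2,a,d)d(x,y)∕L}∕R` (mean value on the unit disc with the Cauchy derivative bound).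
[cite: Balaban1985BackgroundPropagators, Thm 3.4 p.400, (3.48)–(3.50) pp.398–400] -/
theorem norm_blk_printMap_sub_le (hR2 : 2 ≤ R) (x y : Tor (fine L M)) :
    ‖blk (cxFullOp T M a ((L : ℝ) ^ 2) m2 (U₀ + δU) (fun bd => ((U₀ + δU) bd)⁻¹))⁻¹ x y - blk (cxFullOp T M a ((L : ℝ) ^ 2) m2 U₀ (fun bd => (U₀ bd)⁻¹))⁻¹ x y‖
      ≤ 16 / κ * Real.exp (-(ctRate (κ / 2) a d / L * tdistT (fine L M) x y)) / R := by
  set f : ℂ → Matrix n n ℂ := fun s => blk (cxFullOp T M a ((L : ℝ) ^ 2) m2 (U₀ + s • δU) (fun bd => ((U₀ + s • δU) bd)⁻¹))⁻¹ x y with hf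
  set B : ℝ := 8 / κ * Real.exp (-(ctRate (κ / 2) a d / L * tdistT (fine L M) x y)) with hB
  have hball : ∀ s ∈ closedBall (0 : ℂ) 1, ‖s‖ ≤ R / 2 := fun s hs => by
    have : ‖s‖ ≤ 1 := by simpa only [mem_closedBall, dist_zero_right] using hs
    linarith
  have hdiff : ∀ s ∈ closedBall (0 : ℂ) 1, DifferentiableAt ℂ f s := fun s hs =>
    differentiableAt_blk_printLine T M hD ha hm hL hU₀ hκ hcoer hε0 hδU hR hrad ((hball s hs).trans (by linarith)) x y
  have hbound : ∀ s ∈ closedBall (0 : ℂ) 1, ‖deriv f s‖ ≤ B / (R / 2) := fun s hs => norm_deriv_blk_printLine_le T M hD ha hm hL hU₀ hκ hcoer hε0 hδU hR hrad (hball s hs) x y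
  have h := (convex_closedBall (0 : ℂ) 1).norm_image_sub_le_of_norm_deriv_le hdiff hbound (x := 0) (y := 1)
    (mem_closedBall_self zero_le_one) (by rw [mem_closedBall, dist_zero_right, norm_one])
  have e1 : f 1 = blk (cxFullOp T M a ((L : ℝ) ^ 2) m2 (U₀ + δU) (fun bd => ((U₀ + δU) bd)⁻¹))⁻¹ x y := by simp only [hf, one_smul]
  have e0 : f 0 = blk (cxFullOp T M a ((L : ℝ) ^ 2) m2 U₀ (fun bd => (U₀ bd)⁻¹))⁻¹ x y := by simp only [hf, zero_smul, add_zero]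
  rw [← e1, ← e0]
  calc ‖f 1 - f 0‖ ≤ B / (R / 2) * ‖(1 : ℂ) - 0‖ := h
    _ = 16 / κ * Real.exp (-(ctRate (κ / 2) a d / L * tdistT (fine L M) x y)) / R := by rw [sub_zero, norm_one, mul_one, hB]; ring

end Line

/-! ## §3 (continued) Unitary endpoints: the `η`-uniform Lipschitz bound with decay -/

section Lipschitz

variable (hD : ∀ j, T.depth j ≤ (d + 1) * (L - 1)) {a m2 : ℝ} (ha : 0 ≤ a) (hm : 0 ≤ m2) (hL : 1 ≤ L)
variable {U₀ U₁ : Tor (fine L M) × Fin (d + 1) → Matrix n n ℂ} (hU₀ : ∀ bd, U₀ bd ∈ Matrix.unitaryGroup n ℂ) (hU₁ : ∀ bd, U₁ bd ∈ Matrix.unitaryGroup n ℂ) {κ : ℝ} (hκ : 0 < κ)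
  (hcoer : ∀ v : Tor (fine L M) × n → ℂ, κ * ∑ x, ‖fib (fine L M) v x‖ ^ 2 ≤ RCLike.re (star v ⬝ᵥ (fullOpU T M a ((L : ℝ) ^ 2) m2 U₀ *ᵥ v)))
variable {ε : ℝ} (hε : 0 < ε) (hU : ∀ bd, ‖U₁ bd - U₀ bd‖ ≤ ε) (h2 : 2 * ((L : ℝ) * ε) ≤ sliceRadius κ a d)
include hD ha hm hL hU₀ hU₁ hκ hcoer hε hU h2

/-- ★★★★ **THE `η`-UNIFORM LIPSCHITZ DEPENDENCE WITH DECAY** (door (t9⁵⁶)): for UNITARY `U₀, U₁` with `‖U₁_b − U₀_b‖ ≤ ε` on every bond, `0 < ε`, `2Lε ≤ s₀(κ,a,d)`, `A₀(U₀)` `κ`-coercive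
(King's scaling, comb-depth contours, `L ≥ 1`, `a, m² ≥ 0`):  `‖blk (A₀(U₁)⁻¹ − A₀(U₀)⁻¹) x y‖ ≤ (16∕κ)·(Lε∕s₀(κ,a,d))·e^{−ctRate(κ∕2,a,d)·d(x,y)∕L}` for all sites — linear in `Lε = ε∕η`, constant and
rate depending on `(κ,a,d)` only, the full exponential decay kept. [cite: Balaban1985BackgroundPropagators, Thm 3.1 p.397, Thm 3.4 p.400, (3.48)–(3.50) pp.398–400; King1986, (4.33) p.674] -/
theorem norm_blk_fullOpU_inv_sub_le_eta_uniform (x y : Tor (fine L M)) :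
    ‖blk ((fullOpU T M a ((L : ℝ) ^ 2) m2 U₁)⁻¹ - (fullOpU T M a ((L : ℝ) ^ 2) m2 U₀)⁻¹) x y‖
      ≤ 16 / κ * ((L : ℝ) * ε / sliceRadius κ a d) * Real.exp (-(ctRate (κ / 2) a d / L * tdistT (fine L M) x y)) := by
  have hs0 : 0 < sliceRadius κ a d := sliceRadius_pos hκ ha d
  have hL0 : (0 : ℝ) < L := by exact_mod_cast hL
  have hLε : 0 < (L : ℝ) * ε := mul_pos hL0 hε
  set R : ℝ := sliceRadius κ a d / ((L : ℝ) * ε) with hRdef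
  have hR0 : 0 < R := div_pos hs0 hLε
  have hR2 : 2 ≤ R := by rw [hRdef, le_div_iff₀ hLε]; exact h2
  have hrad : (L : ℝ) * (R * ε) ≤ sliceRadius κ a d := by
    rw [hRdef]; rw [show (L : ℝ) * (sliceRadius κ a d / ((L : ℝ) * ε) * ε) = sliceRadius κ a d by field_simp]
  have hδU : ∀ bd, ‖(U₁ - U₀) bd‖ ≤ ε := fun bd => by rw [Pi.sub_apply]; exact hU bd
  have h := norm_blk_printMap_sub_le T M hD ha hm hL hU₀ hκ hcoer hε.le hδU hR0 hrad hR2 x y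
  rw [add_sub_cancel, cxFullOp_inv_of_unitary T M a _ m2 hU₁, cxFullOp_inv_of_unitary T M a _ m2 hU₀, ← blk_sub'] at h
  refine h.trans (le_of_eq ?_)
  rw [hRdef]
  field_simp

end Lipschitz

/-- ★★★ **ON THE SMALL-CURVATURE CLASS ALL CONSTANTS ARE FUNCTIONS OF (m²,a,d,ε₀)**: comb, `L ≥ 2`, unitary `U₀` with `‖P_{U₀} − 1‖ ≤ ε₀∕L²`, `κ₀ = m² + min(a,(2(d+1))⁻¹) − (d+1)d²ε₀² > 0`, unitary
`U₁` with `‖U₁ − U₀‖ ≤ ε`, `2Lε ≤ s₀(κ₀,a,d)`:  `‖blk (A₀(U₁)⁻¹ − A₀(U₀)⁻¹) x y‖ ≤ (16∕κ₀)(Lε∕s₀(κ₀,a,d))e^{−ctRate(κ₀∕2,a,d)d(x,y)∕L}`.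
[cite: Balaban1985BackgroundPropagators, Thm 3.1 p.397, (3.35) p.396, Thm 3.4 p.400, (3.48)–(3.50) pp.398–400] -/
theorem norm_blk_fullOpU_inv_sub_le_small_curvature (hL : 2 ≤ L) {a m2 : ℝ} (ha : 0 ≤ a) (hm : 0 ≤ m2) {U₀ U₁ : Tor (fine L M) × Fin (d + 1) → Matrix n n ℂ}
    (hU₀ : ∀ bd, U₀ bd ∈ Matrix.unitaryGroup n ℂ) (hU₁ : ∀ bd, U₁ bd ∈ Matrix.unitaryGroup n ℂ)
    {ε₀ : ℝ} (hP : ∀ (x : Tor (fine L M)) (κ ρ : Fin (d + 1)), ‖kingPlaq (fine L M) U₀ x κ ρ - 1‖ ≤ ε₀ / (L : ℝ) ^ 2)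
    (hκ₀ : 0 < m2 + min a (1 / (2 * ((d : ℝ) + 1))) - ((d : ℝ) + 1) * (d : ℝ) ^ 2 * ε₀ ^ 2)
    {ε : ℝ} (hε : 0 < ε) (hU : ∀ bd, ‖U₁ bd - U₀ bd‖ ≤ ε) (h2 : 2 * ((L : ℝ) * ε) ≤ sliceRadius (m2 + min a (1 / (2 * ((d : ℝ) + 1))) - ((d : ℝ) + 1) * (d : ℝ) ^ 2 * ε₀ ^ 2) a d)
    (x y : Tor (fine L M)) :
    ‖blk ((fullOpU (kingComb d L) M a ((L : ℝ) ^ 2) m2 U₁)⁻¹ - (fullOpU (kingComb d L) M a ((L : ℝ) ^ 2) m2 U₀)⁻¹) x y‖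
      ≤ 16 / (m2 + min a (1 / (2 * ((d : ℝ) + 1))) - ((d : ℝ) + 1) * (d : ℝ) ^ 2 * ε₀ ^ 2)
        * ((L : ℝ) * ε / sliceRadius (m2 + min a (1 / (2 * ((d : ℝ) + 1))) - ((d : ℝ) + 1) * (d : ℝ) ^ 2 * ε₀ ^ 2) a d)
        * Real.exp (-(ctRate ((m2 + min a (1 / (2 * ((d : ℝ) + 1))) - ((d : ℝ) + 1) * (d : ℝ) ^ 2 * ε₀ ^ 2) / 2) a d / L * tdistT (fine L M) x y)) :=
  norm_blk_fullOpU_inv_sub_le_eta_uniform (kingComb d L) M (kingComb_depth_le (d := d) (L := L)) ha hm (by omega) hU₀ hU₁ hκ₀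
    (re_quadForm_fullOpU_ge_uniform_of_small_curvature M hL a m2 hU₀ hP) hε hU h2 x y

end Summit.QuantumFields.YangMills.BalabanUVNodes.N15KingModelRung.Analytic

end
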